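import Summits.BirchSwinnertonDyer.BirchSwinnertonDyer.Theses.PrintCf2
import Summits.BirchSwinnertonDyer.BirchSwinnertonDyer.Theorems.PrintCf2RamifiedOffTYZLargeConductor
import Summits.BirchSwinnertonDyer.Rank1Residual.P2.CongruentNumberLevelTwoDoor
import HarnessLib

/-!
# Route `PrintCf2`, crux stmt-BirchSwinnertonDyer-20509 `RamifiedOffTYZOfFacts` — ISOGENY SATURATION OF THE JUMP-ONE
# CLASS: granted C⁺ (`stub_offTYZ_levelTwoScriptLExact`), GZK, modularity and Cassels' invariance (conjuncts 1–3, 5 of 𝔅_ram),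
# `BSD(W, 2)` holds for EVERY globally minimal `W` of analytic rank one that is `ℚ`-ISOGENOUS to a jump-one `E_n`; the
# residual stub of skeleton v7 re-cut accordingly (skeleton v8; cell `bsd-print-cf2`, LEAD of 20509, line `offtyz-v7`)

HONEST FRAMING (cell `bsd-print-cf2`, run/shared/lean/pub/bsd-print-cf2/; route `PrintCf2`; crux 20509 =
`𝔅_ram → WAllCornerFTwoRamifiedOffTYZProved`, the DECIDING crux, OPEN AS A CLASS — an open problem in print): bookkeeping
only — no named fact is introduced, nothing is asserted, no `def`. Skeleton v7 of the crux (planner g12, sha16 54d7f62729747b28,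
`Cruxes/RamifiedOffTYZOfFacts/Lines/offtyz-v7.lean`) cut v6's large-conductor residual along the LANDED level-two door
(`Rank1Residual/P2/CongruentNumberLevelTwoDoor.lean`, ty2 g11): the research stub C⁺ = `stub_offTYZ_levelTwoScriptLExact`
(«`2 ∥ 𝓛(n)` on the jump-one class: `n` square-free, `n ≡ 5, 6, 7 (mod 8)`, `ord_{s=1} L(E_n, s) = 1`, `#Sel₂(E_n) = 2⁵`,
`#Sel₄(E_n) = 2⁶`»; OPEN, NO PRINT) gives `BSD(W, 2)` for every globally minimal `ℚ`-MODEL `W = C • E_n` of a member, and the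
complementary stub `stub_offTYZ_residualOffJumpOne` excluded exactly those models. The line card (`Lines/offtyz-v7.md`,
«isogeny saturation … is a routine add-on for the lead») asks for the `ℚ`-ISOGENY class instead: `E_n : y² = x³ − n²x` has the
`ℚ`-isogeny class `{E_n, y² = x³ + 4n²x (j = 1728), two curves with j = 287496}` (Cremona class `32a` twisted), all CM by an
order of `ℚ(i)`, all of the same analytic rank (Faltings: isogenous curves have the same `L`-function,
`analyticRank_eq_of_isIsogenous'`, PROVED in the tree) and with `BSD(·, 2)` constant on the class granted Cassels' invariance of
the BSD quotient (conjunct 3 of 𝔅_ram, `WeierstrassCurve.bsdRHS_eq_of_isIsogenous`) — `Wuthrich2014.bsdp_of_isIsogenous`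
(Milne ADT I.7.3, PROVED modulo that conjunct). Hence:

* §1 `bsdp_two_of_isIsogenous_jumpOne_of_levelTwoScriptLExact` — granted C⁺ (hypothesis, verbatim binder shape), TYZ Thm 1.2′
  (integrality of `𝓛(n)`), GZK, modularity and Cassels: every globally minimal `W` with `W.analyticRank = 1` that is
  `ℚ`-isogenous to a jump-one `E_n` satisfies `BSD(W, 2)`. (The member case `C • E_n = W` of v7 is the special case
  `isIsogenous_of_smul_eq'`, §1 `…_of_smul`.)
* §2 `offTYZ_residualV6_of_levelTwo_of_offJumpOneIsogeny` — the GLUE of skeleton v8: v6's large-conductor residual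
  (`… 5000 ≤ N_W ⇒ BSD(W,2)`) from C⁺ and the residual OFF THE ISOGENY CLASSES of jump-one `E_n` (the reshaped stub
  `stub_offTYZ_residualOffJumpOneIsogeny`: one more negated hypothesis `¬ ∃ n, … ∧ IsIsogenous W (E_n)`), by excluded middle.
* §3 `offJumpOneIsogeny_of_offJumpOne` — the reshape is CONSERVATIVE: v7's stub `stub_offTYZ_residualOffJumpOne` (off the
  ℚ-models only) implies the v8 stub, so every proof aimed at the v7 signature still lands.
* §4 `ramifiedOffTYZOfFacts_of_leaves_of_levelTwo_of_offJumpOneIsogeny` — the COMPOSITION of skeleton v8 as one theorem with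
  the eight stub statements as hypotheses (six print-door leaves VERBATIM v6/v7 + C⁺ + the isogeny-saturated residual), through
  p1 g4's `offTYZProved_of_bundle_of_uPlus_of_theta_of_shuZhai_of_thetaFour_of_thetaCriterion_of_smallConductor_of_offLarge`
  (p569950); the skeleton's `RamifiedOffTYZOfFacts_of` is this theorem applied to the stubs.

What the isogeny saturation removes from the residual, by name: for every jump-one `E_n` (s(n) = 3, Cassels–Tate step
non-degenerate) of analytic rank one, its `j = 1728` partner `y² = x³ + 4n²x` and its two `j = 287496` partners (conductor
`32n²` resp. `16n²`, all `≥ 5000` as soon as `n ≥ 13`; census G-locus k ≤ 2, n ≤ 10⁵: 2196 classes, kit j299242). What stays: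
v6's residual off every booked / Shu–Zhai / four-prime-theta / Θ-criterion class, in conductor `≥ 5000`, and now also off the
isogeny class of every jump-one `E_n` — i.e. the `E_m` classes with `s(m) = 3` and Ш[4] ≠ Ш[2] (level ≥ 3), `s(m) ≥ 5`,
`s(m) = 1` with even genus sums, the quartic twists `y² = x³ + Dx` (`−D ∉ ℚ²`, `±D ∉ 4ℚ²·n²`-shape) isogenous to no `E_m`,
and all of `j = 8000` (`K = ℚ(√−2)`). beyond-print theorem: NO (bookkeeping; the research content is C⁺ and the residual).
BSD is not proved by any of this; no class is closed by this file.

References: [cite: MilneADT2006, Thm. I.7.3] (Cassels–Tate isogeny invariance of the BSD quotient); [cite: Knapp1993, Thm. 11.67]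
(isogenous curves have equal `L`-functions); [cite: Miller2011LMS, Def. 1.1] (`BSD(E,p)`); [cite: TianYuanZhang2017, Thm. 1.2
and §1 (1.1)]; [cite: CremonaAlgorithms1997, Table 1 (class 32a)]; [cite: SilvermanAEC2009, III.4 and III.6.1].
-/

noncomputable section

open scoped Classical

open WeierstrassCurve Summit.BirchSwinnertonDyer Summit.BirchSwinnertonDyer.Rank1Residual
  Literature.NumberTheory.EllipticCurves Literature.NumberTheory.EllipticCurves.Rank1Residual
  Literature.NumberTheory.EllipticCurves.TianYuanZhang2017

set_option autoImplicit false

namespace Summit.BirchSwinnertonDyer.PrintCf2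

/-! ## §1 `BSD(·, 2)` is constant on the `ℚ`-isogeny class of a jump-one `E_n` of analytic rank one, granted C⁺ -/

/-- **Isogeny saturation of the level-two door.** Granted TYZ Thm 1.2′ (`h12`, integrality of `𝓛(n)`), GZK (`hGZK`),
modularity (`hL`), Cassels' isogeny invariance of the BSD quotient (`hCassels`) and the research statement C⁺ in its
registered binder shape (`hC` = `stub_offTYZ_levelTwoScriptLExact`): if a globally minimal `W/ℚ` of analytic rank one is
`ℚ`-isogenous to `E_n : y² = x³ − n²x` with `n` square-free, `n ≡ 5, 6, 7 (mod 8)`, `#Sel₂(E_n) = 2⁵`, `#Sel₄(E_n) = 2⁶`, then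
`BSD(W, 2)`. Proof: `r_an(E_n) = r_an(W) = 1` (Faltings/Knapp 11.67), `BSD(E_n, 2)` by the door
`P2.bsdp_two_congruentNumberCurve_of_levelTwoScriptLExact`, transport by `Wuthrich2014.bsdp_of_isIsogenous` (Ш(E_n) finite by
GZK, `L′(E_n,1) ≠ 0` by modularity). [cite: MilneADT2006, Thm. I.7.3] [cite: Knapp1993, Thm. 11.67] [cite: TianYuanZhang2017, Thm. 1.2 and §1 (1.1)] -/
theorem bsdp_two_of_isIsogenous_jumpOne_of_levelTwoScriptLExact
    (h12 : thm12_parity_of_scriptL') (hGZK : rank_eq_analyticRank_of_analyticRank_le_one)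
    (hL : hasEntireLFunction_rat) (hCassels : bsdRHS_eq_of_isIsogenous)
    (hC : (∀ (n : ℕ) [(congruentNumberCurve n).IsElliptic] [(congruentNumberCurve n).IsGloballyMinimal],
      Squarefree n → (n % 8 = 5 ∨ n % 8 = 6 ∨ n % 8 = 7) →
      (congruentNumberCurve n).analyticRank = 1 →
      Nat.card ((congruentNumberCurve n).selmerGroup 2) = 2 ^ 5 →
      Nat.card ((congruentNumberCurve n).selmerGroup 4) = 2 ^ 6 →
      ∀ L : ℤ, IsScriptL n L → (2 : ℤ) ∣ L ∧ ¬ (4 : ℤ) ∣ L))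
    {W : WeierstrassCurve ℚ} [W.IsElliptic] [W.IsGloballyMinimal] (hrW : W.analyticRank = 1)
    {n : ℕ} (hsq : Squarefree n) (h8 : n % 8 = 5 ∨ n % 8 = 6 ∨ n % 8 = 7)
    (hS₂ : Nat.card ((congruentNumberCurve n).selmerGroup 2) = 2 ^ 5)
    (hS₄ : Nat.card ((congruentNumberCurve n).selmerGroup 4) = 2 ^ 6)
    (hiso : IsIsogenous W (congruentNumberCurve n)) : BSDp W 2 := by
  haveI := isElliptic_congruentNumberCurve hsq.ne_zero
  haveI := isGloballyMinimal_congruentNumberCurve hsq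
  have hr : (congruentNumberCurve n).analyticRank = 1 :=
    (analyticRank_eq_of_isIsogenous' hiso).symm.trans hrW
  have h₀ : BSDp (congruentNumberCurve n) 2 :=
    (P2.bsdp_two_congruentNumberCurve_of_levelTwoScriptLExact h12 hGZK hC hsq h8 hr hS₂ hS₄).2.2
  exact Wuthrich2014.bsdp_of_isIsogenous hCassels hiso (hGZK (congruentNumberCurve n) hr.le).2
    ((congruentNumberCurve n).leadingLCoeff_ne_zero_holds (hL (congruentNumberCurve n))) h₀

/-- A `ℚ`-model `W = C • E_n` is `ℚ`-isogenous to `E_n` (the v7 member case inside the v8 isogeny case).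
[cite: SilvermanAEC2009, III.3.1(b) and III.4 (Def.)] -/
theorem isIsogenous_congruentNumberCurve_of_smul {W : WeierstrassCurve ℚ} {n : ℕ} {C : VariableChange ℚ}
    (h : C • congruentNumberCurve n = W) : IsIsogenous W (congruentNumberCurve n) :=
  isIsogenous_of_smul_eq' h

/-- The jump-one MODEL witness of v7 yields the jump-one ISOGENY witness of v8. [cite: SilvermanAEC2009, III.4 (Def.)] -/
theorem jumpOneIsogeny_of_jumpOneModel {W : WeierstrassCurve ℚ}
    (h : (∃ (n : ℕ) (C : WeierstrassCurve.VariableChange ℚ), Squarefree n ∧ (n % 8 = 5 ∨ n % 8 = 6 ∨ n % 8 = 7) ∧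
            Nat.card ((congruentNumberCurve n).selmerGroup 2) = 2 ^ 5 ∧
            Nat.card ((congruentNumberCurve n).selmerGroup 4) = 2 ^ 6 ∧ C • congruentNumberCurve n = W)) :
    (∃ n : ℕ, Squarefree n ∧ (n % 8 = 5 ∨ n % 8 = 6 ∨ n % 8 = 7) ∧
            Nat.card ((congruentNumberCurve n).selmerGroup 2) = 2 ^ 5 ∧
            Nat.card ((congruentNumberCurve n).selmerGroup 4) = 2 ^ 6 ∧ IsIsogenous W (congruentNumberCurve n)) := by
  obtain ⟨n, C, hsq, h8, hS₂, hS₄, hCW⟩ := h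
  exact ⟨n, hsq, h8, hS₂, hS₄, isIsogenous_congruentNumberCurve_of_smul hCW⟩

/-- **The bundle form of §1**: granted 𝔅_ram (conjuncts 1, 2, 3, 5 used) and C⁺, every globally minimal `W` of analytic rank
one admitting a jump-one isogeny witness satisfies `BSD(W, 2)`. [cite: MilneADT2006, Thm. I.7.3] [cite: TianYuanZhang2017, Thm. 1.2 and §1 (1.1)] -/
theorem bsdp_two_of_bundle_of_levelTwoScriptLExact_of_jumpOneIsogeny
    (hB : (Literature.NumberTheory.EllipticCurves.rank_eq_analyticRank_of_analyticRank_le_one ∧ WeierstrassCurve.hasEntireLFunction_rat ∧ WeierstrassCurve.bsdRHS_eq_of_isIsogenous ∧ Literature.NumberTheory.EllipticCurves.bsdTriple_of_hasCM_of_L_one_ne_zero ∧ Literature.NumberTheory.EllipticCurves.TianYuanZhang2017.thm12_parity_of_scriptL' ∧ Literature.NumberTheory.EllipticCurves.Tian2014.thm13_rank_one_and_sha_odd ∧ Literature.NumberTheory.QuadraticFields.RedeiReichardt.redeiReichardt_fourTwoCard_classGroup ∧ Literature.NumberTheory.EllipticCurves.LiLiuTian2024.thm12_bsd_congruentNumberCurve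 ∧ Literature.NumberTheory.EllipticCurves.Monsky1990.cor515_rank_eq_one_and_card_selmerGroup_two ∧ Literature.NumberTheory.EllipticCurves.HeathBrown1994.monsky_card_selmerGroup_two_even ∧ Literature.NumberTheory.EllipticCurves.Tian2014.tian2014_system_sMinus_genus))
    (hC : (∀ (n : ℕ) [(congruentNumberCurve n).IsElliptic] [(congruentNumberCurve n).IsGloballyMinimal],
      Squarefree n → (n % 8 = 5 ∨ n % 8 = 6 ∨ n % 8 = 7) →
      (congruentNumberCurve n).analyticRank = 1 →
      Nat.card ((congruentNumberCurve n).selmerGroup 2) = 2 ^ 5 →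
      Nat.card ((congruentNumberCurve n).selmerGroup 4) = 2 ^ 6 →
      ∀ L : ℤ, IsScriptL n L → (2 : ℤ) ∣ L ∧ ¬ (4 : ℤ) ∣ L))
    {W : WeierstrassCurve ℚ} [W.IsElliptic] [W.IsGloballyMinimal] (hrW : W.analyticRank = 1)
    (hJ : (∃ n : ℕ, Squarefree n ∧ (n % 8 = 5 ∨ n % 8 = 6 ∨ n % 8 = 7) ∧
            Nat.card ((congruentNumberCurve n).selmerGroup 2) = 2 ^ 5 ∧
            Nat.card ((congruentNumberCurve n).selmerGroup 4) = 2 ^ 6 ∧ IsIsogenous W (congruentNumberCurve n))) :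
    BSDp W 2 := by
  obtain ⟨n, hsq, h8, hS₂, hS₄, hiso⟩ := hJ
  exact bsdp_two_of_isIsogenous_jumpOne_of_levelTwoScriptLExact hB.2.2.2.2.1 hB.1 hB.2.1 hB.2.2.1 hC hrW hsq h8
    hS₂ hS₄ hiso

/-! ## §2 The glue of skeleton v8: v6's residual from C⁺ and the residual off the jump-one ISOGENY classes -/

/-- **GLUE (skeleton v8).** v6's large-conductor residual stub (`stub_offTYZ_residual` of v6: CM, `r_an = 1`, `2 ∣ d_K`, off
the booked / Shu–Zhai / four-prime-theta / Θ-criterion classes, `N ≥ 5000` ⇒ `BSD(W,2)`) follows from C⁺ (`hC`) and the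
residual OFF THE `ℚ`-ISOGENY CLASSES of the jump-one `E_n` (`hR`, the reshaped stub `stub_offTYZ_residualOffJumpOneIsogeny`),
by excluded middle on the isogeny witness; the witness case is §1. [cite: MilneADT2006, Thm. I.7.3] -/
theorem offTYZ_residualV6_of_levelTwo_of_offJumpOneIsogeny
    (hC : (∀ (n : ℕ) [(congruentNumberCurve n).IsElliptic] [(congruentNumberCurve n).IsGloballyMinimal],
      Squarefree n → (n % 8 = 5 ∨ n % 8 = 6 ∨ n % 8 = 7) →
      (congruentNumberCurve n).analyticRank = 1 →
      Nat.card ((congruentNumberCurve n).selmerGroup 2) = 2 ^ 5 →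
      Nat.card ((congruentNumberCurve n).selmerGroup 4) = 2 ^ 6 →
      ∀ L : ℤ, IsScriptL n L → (2 : ℤ) ∣ L ∧ ¬ (4 : ℤ) ∣ L))
    (hR : (Literature.NumberTheory.EllipticCurves.rank_eq_analyticRank_of_analyticRank_le_one ∧ WeierstrassCurve.hasEntireLFunction_rat ∧ WeierstrassCurve.bsdRHS_eq_of_isIsogenous ∧ Literature.NumberTheory.EllipticCurves.bsdTriple_of_hasCM_of_L_one_ne_zero ∧ Literature.NumberTheory.EllipticCurves.TianYuanZhang2017.thm12_parity_of_scriptL' ∧ Literature.NumberTheory.EllipticCurves.Tian2014.thm13_rank_one_and_sha_odd ∧ Literature.NumberTheory.QuadraticFields.RedeiReichardt.redeiReichardt_fourTwoCard_classGroup ∧ Literature.NumberTheory.EllipticCurves.LiLiuTian2024.thm12_bsd_congruentNumberCurve ∧ Literature.NumberTheory.EllipticCurves.Monsky1990.cor515_rank_eq_one_and_card_selmerGroup_two ∧ Literature.NumberTheory.EllipticCurves.HeathBrown1994.monsky_card_selmerGroup_two_even ∧ Literature.NumberTheory.EllipticCurves.Tian2014.tian2014_system_sMinus_genus) →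
    (∀ (W : WeierstrassCurve ℚ) [W.IsElliptic] [W.IsGloballyMinimal],
      W.HasCM → W.analyticRank = 1 → Literature.NumberTheory.EllipticCurves.Rank1Residual.CMRamified W 2 →
        ¬ Summit.BirchSwinnertonDyer.CongruentBookedIsogenyClass W →
        ¬ Summit.BirchSwinnertonDyer.Rank1Residual.P2.IsIsogenousToShuZhaiTwoFiftySixTwist W →
        ¬ Summit.BirchSwinnertonDyer.CongruentThetaFourIsogenyClass W →
        ¬ Summit.BirchSwinnertonDyer.CongruentThetaCriterionIsogenyClass W →
        5000 ≤ W.conductorNorm ℤ →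
        ¬ (∃ n : ℕ, Squarefree n ∧ (n % 8 = 5 ∨ n % 8 = 6 ∨ n % 8 = 7) ∧
            Nat.card ((congruentNumberCurve n).selmerGroup 2) = 2 ^ 5 ∧
            Nat.card ((congruentNumberCurve n).selmerGroup 4) = 2 ^ 6 ∧ IsIsogenous W (congruentNumberCurve n)) →
        Literature.NumberTheory.EllipticCurves.BSDp W 2)) :
    (Literature.NumberTheory.EllipticCurves.rank_eq_analyticRank_of_analyticRank_le_one ∧ WeierstrassCurve.hasEntireLFunction_rat ∧ WeierstrassCurve.bsdRHS_eq_of_isIsogenous ∧ Literature.NumberTheory.EllipticCurves.bsdTriple_of_hasCM_of_L_one_ne_zero ∧ Literature.NumberTheory.EllipticCurves.TianYuanZhang2017.thm12_parity_of_scriptL' ∧ Literature.NumberTheory.EllipticCurves.Tian2014.thm13_rank_one_and_sha_odd ∧ Literature.NumberTheory.QuadraticFields.RedeiReichardt.redeiReichardt_fourTwoCard_classGroup ∧ Literature.NumberTheory.EllipticCurves.LiLiuTian2024.thm12_bsd_congruentNumberCurve ∧ Literature.NumberTheory.EllipticCurves.Monsky1990.cor515_rank_eq_one_and_card_selmerGroup_two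 ∧ Literature.NumberTheory.EllipticCurves.HeathBrown1994.monsky_card_selmerGroup_two_even ∧ Literature.NumberTheory.EllipticCurves.Tian2014.tian2014_system_sMinus_genus) →
    (∀ (W : WeierstrassCurve ℚ) [W.IsElliptic] [W.IsGloballyMinimal],
      W.HasCM → W.analyticRank = 1 → Literature.NumberTheory.EllipticCurves.Rank1Residual.CMRamified W 2 →
        ¬ Summit.BirchSwinnertonDyer.CongruentBookedIsogenyClass W →
        ¬ Summit.BirchSwinnertonDyer.Rank1Residual.P2.IsIsogenousToShuZhaiTwoFiftySixTwist W →
        ¬ Summit.BirchSwinnertonDyer.CongruentThetaFourIsogenyClass W →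
        ¬ Summit.BirchSwinnertonDyer.CongruentThetaCriterionIsogenyClass W →
        5000 ≤ W.conductorNorm ℤ → Literature.NumberTheory.EllipticCurves.BSDp W 2) := by
  intro hB W _ _ hCM hr hram hb hz ht4 htc hN
  by_cases hJ : (∃ n : ℕ, Squarefree n ∧ (n % 8 = 5 ∨ n % 8 = 6 ∨ n % 8 = 7) ∧
            Nat.card ((congruentNumberCurve n).selmerGroup 2) = 2 ^ 5 ∧
            Nat.card ((congruentNumberCurve n).selmerGroup 4) = 2 ^ 6 ∧ IsIsogenous W (congruentNumberCurve n))
  · exact bsdp_two_of_bundle_of_levelTwoScriptLExact_of_jumpOneIsogeny hB hC hr hJ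
  · exact hR hB W hCM hr hram hb hz ht4 htc hN hJ

/-! ## §3 The reshape is conservative: v7's residual stub implies v8's -/

/-- **v7 ⟹ v8 for the residual stub.** A `W` isogenous to no jump-one `E_n` is in particular a `ℚ`-model of none, so the v7
statement `stub_offTYZ_residualOffJumpOne` (off the models) implies the v8 statement `stub_offTYZ_residualOffJumpOneIsogeny`
(off the isogeny classes): the v8 stub is WEAKER (more hypotheses), every v7-aimed proof still lands. [cite: SilvermanAEC2009, III.4 (Def.)] -/
theorem offJumpOneIsogeny_of_offJumpOne
    (h7 : (Literature.NumberTheory.EllipticCurves.rank_eq_analyticRank_of_analyticRank_le_one ∧ WeierstrassCurve.hasEntireLFunction_rat ∧ WeierstrassCurve.bsdRHS_eq_of_isIsogenous ∧ Literature.NumberTheory.EllipticCurves.bsdTriple_of_hasCM_of_L_one_ne_zero ∧ Literature.NumberTheory.EllipticCurves.TianYuanZhang2017.thm12_parity_of_scriptL' ∧ Literature.NumberTheory.EllipticCurves.Tian2014.thm13_rank_one_and_sha_odd ∧ Literature.NumberTheory.QuadraticFields.RedeiReichardt.redeiReichardt_fourTwoCard_classGroup ∧ Literature.NumberTheory.EllipticCurves.LiLiuTian2024.thm12_bsd_congruentNumberCurve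 ∧ Literature.NumberTheory.EllipticCurves.Monsky1990.cor515_rank_eq_one_and_card_selmerGroup_two ∧ Literature.NumberTheory.EllipticCurves.HeathBrown1994.monsky_card_selmerGroup_two_even ∧ Literature.NumberTheory.EllipticCurves.Tian2014.tian2014_system_sMinus_genus) →
    (∀ (W : WeierstrassCurve ℚ) [W.IsElliptic] [W.IsGloballyMinimal],
      W.HasCM → W.analyticRank = 1 → Literature.NumberTheory.EllipticCurves.Rank1Residual.CMRamified W 2 →
        ¬ Summit.BirchSwinnertonDyer.CongruentBookedIsogenyClass W →
        ¬ Summit.BirchSwinnertonDyer.Rank1Residual.P2.IsIsogenousToShuZhaiTwoFiftySixTwist W →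
        ¬ Summit.BirchSwinnertonDyer.CongruentThetaFourIsogenyClass W →
        ¬ Summit.BirchSwinnertonDyer.CongruentThetaCriterionIsogenyClass W →
        5000 ≤ W.conductorNorm ℤ →
        ¬ (∃ (n : ℕ) (C : WeierstrassCurve.VariableChange ℚ), Squarefree n ∧ (n % 8 = 5 ∨ n % 8 = 6 ∨ n % 8 = 7) ∧
            Nat.card ((congruentNumberCurve n).selmerGroup 2) = 2 ^ 5 ∧
            Nat.card ((congruentNumberCurve n).selmerGroup 4) = 2 ^ 6 ∧ C • congruentNumberCurve n = W) →
        Literature.NumberTheory.EllipticCurves.BSDp W 2)) :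
    (Literature.NumberTheory.EllipticCurves.rank_eq_analyticRank_of_analyticRank_le_one ∧ WeierstrassCurve.hasEntireLFunction_rat ∧ WeierstrassCurve.bsdRHS_eq_of_isIsogenous ∧ Literature.NumberTheory.EllipticCurves.bsdTriple_of_hasCM_of_L_one_ne_zero ∧ Literature.NumberTheory.EllipticCurves.TianYuanZhang2017.thm12_parity_of_scriptL' ∧ Literature.NumberTheory.EllipticCurves.Tian2014.thm13_rank_one_and_sha_odd ∧ Literature.NumberTheory.QuadraticFields.RedeiReichardt.redeiReichardt_fourTwoCard_classGroup ∧ Literature.NumberTheory.EllipticCurves.LiLiuTian2024.thm12_bsd_congruentNumberCurve ∧ Literature.NumberTheory.EllipticCurves.Monsky1990.cor515_rank_eq_one_and_card_selmerGroup_two ∧ Literature.NumberTheory.EllipticCurves.HeathBrown1994.monsky_card_selmerGroup_two_even ∧ Literature.NumberTheory.EllipticCurves.Tian2014.tian2014_system_sMinus_genus) →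
    (∀ (W : WeierstrassCurve ℚ) [W.IsElliptic] [W.IsGloballyMinimal],
      W.HasCM → W.analyticRank = 1 → Literature.NumberTheory.EllipticCurves.Rank1Residual.CMRamified W 2 →
        ¬ Summit.BirchSwinnertonDyer.CongruentBookedIsogenyClass W →
        ¬ Summit.BirchSwinnertonDyer.Rank1Residual.P2.IsIsogenousToShuZhaiTwoFiftySixTwist W →
        ¬ Summit.BirchSwinnertonDyer.CongruentThetaFourIsogenyClass W →
        ¬ Summit.BirchSwinnertonDyer.CongruentThetaCriterionIsogenyClass W →
        5000 ≤ W.conductorNorm ℤ →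
        ¬ (∃ n : ℕ, Squarefree n ∧ (n % 8 = 5 ∨ n % 8 = 6 ∨ n % 8 = 7) ∧
            Nat.card ((congruentNumberCurve n).selmerGroup 2) = 2 ^ 5 ∧
            Nat.card ((congruentNumberCurve n).selmerGroup 4) = 2 ^ 6 ∧ IsIsogenous W (congruentNumberCurve n)) →
        Literature.NumberTheory.EllipticCurves.BSDp W 2) :=
  fun hB W _ _ hCM hr hram hb hz ht4 htc hN hJ ↦
    h7 hB W hCM hr hram hb hz ht4 htc hN fun hM ↦ hJ (jumpOneIsogeny_of_jumpOneModel hM)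

/-! ## §4 The composition of skeleton v8 with the eight stubs as hypotheses -/

/-- **Skeleton v8 of crux 20509, composed.** From 𝔅_ram-relative versions of the six print-door leaves (U⁺ `hU`, theta `hT`,
Shu–Zhai `256c1` `hZ`, four-prime theta `hT4`, Θ-criterion `hTC`, ramified small conductor `hS` — VERBATIM the v6/v7 stubs),
the research statement C⁺ (`hC`) and the isogeny-saturated residual (`hR`): the crux decl `PrintCf2.RamifiedOffTYZOfFacts` BY
NAME. The composition is v6's (p569950) with §2 in the residual slot. [folklore] -/
theorem ramifiedOffTYZOfFacts_of_leaves_of_levelTwo_of_offJumpOneIsogeny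
    (hU : (Literature.NumberTheory.EllipticCurves.rank_eq_analyticRank_of_analyticRank_le_one ∧ WeierstrassCurve.hasEntireLFunction_rat ∧ WeierstrassCurve.bsdRHS_eq_of_isIsogenous ∧ Literature.NumberTheory.EllipticCurves.bsdTriple_of_hasCM_of_L_one_ne_zero ∧ Literature.NumberTheory.EllipticCurves.TianYuanZhang2017.thm12_parity_of_scriptL' ∧ Literature.NumberTheory.EllipticCurves.Tian2014.thm13_rank_one_and_sha_odd ∧ Literature.NumberTheory.QuadraticFields.RedeiReichardt.redeiReichardt_fourTwoCard_classGroup ∧ Literature.NumberTheory.EllipticCurves.LiLiuTian2024.thm12_bsd_congruentNumberCurve ∧ Literature.NumberTheory.EllipticCurves.Monsky1990.cor515_rank_eq_one_and_card_selmerGroup_two ∧ Literature.NumberTheory.EllipticCurves.HeathBrown1994.monsky_card_selmerGroup_two_even ∧ Literature.NumberTheory.EllipticCurves.Tian2014.tian2014_system_sMinus_genus) → Summit.BirchSwinnertonDyer.WAllCornerFTwoRamifiedTYZUPlus)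
    (hT : (Literature.NumberTheory.EllipticCurves.rank_eq_analyticRank_of_analyticRank_le_one ∧ WeierstrassCurve.hasEntireLFunction_rat ∧ WeierstrassCurve.bsdRHS_eq_of_isIsogenous ∧ Literature.NumberTheory.EllipticCurves.bsdTriple_of_hasCM_of_L_one_ne_zero ∧ Literature.NumberTheory.EllipticCurves.TianYuanZhang2017.thm12_parity_of_scriptL' ∧ Literature.NumberTheory.EllipticCurves.Tian2014.thm13_rank_one_and_sha_odd ∧ Literature.NumberTheory.QuadraticFields.RedeiReichardt.redeiReichardt_fourTwoCard_classGroup ∧ Literature.NumberTheory.EllipticCurves.LiLiuTian2024.thm12_bsd_congruentNumberCurve ∧ Literature.NumberTheory.EllipticCurves.Monsky1990.cor515_rank_eq_one_and_card_selmerGroup_two ∧ Literature.NumberTheory.EllipticCurves.HeathBrown1994.monsky_card_selmerGroup_two_even ∧ Literature.NumberTheory.EllipticCurves.Tian2014.tian2014_system_sMinus_genus) → Summit.BirchSwinnertonDyer.WAllCornerFTwoRamifiedTheta)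
    (hZ : (Literature.NumberTheory.EllipticCurves.rank_eq_analyticRank_of_analyticRank_le_one ∧ WeierstrassCurve.hasEntireLFunction_rat ∧ WeierstrassCurve.bsdRHS_eq_of_isIsogenous ∧ Literature.NumberTheory.EllipticCurves.bsdTriple_of_hasCM_of_L_one_ne_zero ∧ Literature.NumberTheory.EllipticCurves.TianYuanZhang2017.thm12_parity_of_scriptL' ∧ Literature.NumberTheory.EllipticCurves.Tian2014.thm13_rank_one_and_sha_odd ∧ Literature.NumberTheory.QuadraticFields.RedeiReichardt.redeiReichardt_fourTwoCard_classGroup ∧ Literature.NumberTheory.EllipticCurves.LiLiuTian2024.thm12_bsd_congruentNumberCurve ∧ Literature.NumberTheory.EllipticCurves.Monsky1990.cor515_rank_eq_one_and_card_selmerGroup_two ∧ Literature.NumberTheory.EllipticCurves.HeathBrown1994.monsky_card_selmerGroup_two_even ∧ Literature.NumberTheory.EllipticCurves.Tian2014.tian2014_system_sMinus_genus) → Summit.BirchSwinnertonDyer.WAllCornerFTwoRamifiedShuZhaiTwoFiftySix)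
    (hT4 : (Literature.NumberTheory.EllipticCurves.rank_eq_analyticRank_of_analyticRank_le_one ∧ WeierstrassCurve.hasEntireLFunction_rat ∧ WeierstrassCurve.bsdRHS_eq_of_isIsogenous ∧ Literature.NumberTheory.EllipticCurves.bsdTriple_of_hasCM_of_L_one_ne_zero ∧ Literature.NumberTheory.EllipticCurves.TianYuanZhang2017.thm12_parity_of_scriptL' ∧ Literature.NumberTheory.EllipticCurves.Tian2014.thm13_rank_one_and_sha_odd ∧ Literature.NumberTheory.QuadraticFields.RedeiReichardt.redeiReichardt_fourTwoCard_classGroup ∧ Literature.NumberTheory.EllipticCurves.LiLiuTian2024.thm12_bsd_congruentNumberCurve ∧ Literature.NumberTheory.EllipticCurves.Monsky1990.cor515_rank_eq_one_and_card_selmerGroup_two ∧ Literature.NumberTheory.EllipticCurves.HeathBrown1994.monsky_card_selmerGroup_two_even ∧ Literature.NumberTheory.EllipticCurves.Tian2014.tian2014_system_sMinus_genus) → Summit.BirchSwinnertonDyer.WAllCornerFTwoRamifiedThetaFour)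
    (hTC : (Literature.NumberTheory.EllipticCurves.rank_eq_analyticRank_of_analyticRank_le_one ∧ WeierstrassCurve.hasEntireLFunction_rat ∧ WeierstrassCurve.bsdRHS_eq_of_isIsogenous ∧ Literature.NumberTheory.EllipticCurves.bsdTriple_of_hasCM_of_L_one_ne_zero ∧ Literature.NumberTheory.EllipticCurves.TianYuanZhang2017.thm12_parity_of_scriptL' ∧ Literature.NumberTheory.EllipticCurves.Tian2014.thm13_rank_one_and_sha_odd ∧ Literature.NumberTheory.QuadraticFields.RedeiReichardt.redeiReichardt_fourTwoCard_classGroup ∧ Literature.NumberTheory.EllipticCurves.LiLiuTian2024.thm12_bsd_congruentNumberCurve ∧ Literature.NumberTheory.EllipticCurves.Monsky1990.cor515_rank_eq_one_and_card_selmerGroup_two ∧ Literature.NumberTheory.EllipticCurves.HeathBrown1994.monsky_card_selmerGroup_two_even ∧ Literature.NumberTheory.EllipticCurves.Tian2014.tian2014_system_sMinus_genus) → Summit.BirchSwinnertonDyer.WAllCornerFTwoRamifiedThetaCriterion)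
    (hS : (Literature.NumberTheory.EllipticCurves.rank_eq_analyticRank_of_analyticRank_le_one ∧ WeierstrassCurve.hasEntireLFunction_rat ∧ WeierstrassCurve.bsdRHS_eq_of_isIsogenous ∧ Literature.NumberTheory.EllipticCurves.bsdTriple_of_hasCM_of_L_one_ne_zero ∧ Literature.NumberTheory.EllipticCurves.TianYuanZhang2017.thm12_parity_of_scriptL' ∧ Literature.NumberTheory.EllipticCurves.Tian2014.thm13_rank_one_and_sha_odd ∧ Literature.NumberTheory.QuadraticFields.RedeiReichardt.redeiReichardt_fourTwoCard_classGroup ∧ Literature.NumberTheory.EllipticCurves.LiLiuTian2024.thm12_bsd_congruentNumberCurve ∧ Literature.NumberTheory.EllipticCurves.Monsky1990.cor515_rank_eq_one_and_card_selmerGroup_two ∧ Literature.NumberTheory.EllipticCurves.HeathBrown1994.monsky_card_selmerGroup_two_even ∧ Literature.NumberTheory.EllipticCurves.Tian2014.tian2014_system_sMinus_genus) →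
    (∀ (W : WeierstrassCurve ℚ) [W.IsElliptic] [W.IsGloballyMinimal],
      W.HasCM → W.analyticRank = 1 → Literature.NumberTheory.EllipticCurves.Rank1Residual.CMRamified W 2 →
        W.conductorNorm ℤ < 5000 → Literature.NumberTheory.EllipticCurves.BSDp W 2))
    (hC : (∀ (n : ℕ) [(congruentNumberCurve n).IsElliptic] [(congruentNumberCurve n).IsGloballyMinimal],
      Squarefree n → (n % 8 = 5 ∨ n % 8 = 6 ∨ n % 8 = 7) →
      (congruentNumberCurve n).analyticRank = 1 →
      Nat.card ((congruentNumberCurve n).selmerGroup 2) = 2 ^ 5 →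
      Nat.card ((congruentNumberCurve n).selmerGroup 4) = 2 ^ 6 →
      ∀ L : ℤ, IsScriptL n L → (2 : ℤ) ∣ L ∧ ¬ (4 : ℤ) ∣ L))
    (hR : (Literature.NumberTheory.EllipticCurves.rank_eq_analyticRank_of_analyticRank_le_one ∧ WeierstrassCurve.hasEntireLFunction_rat ∧ WeierstrassCurve.bsdRHS_eq_of_isIsogenous ∧ Literature.NumberTheory.EllipticCurves.bsdTriple_of_hasCM_of_L_one_ne_zero ∧ Literature.NumberTheory.EllipticCurves.TianYuanZhang2017.thm12_parity_of_scriptL' ∧ Literature.NumberTheory.EllipticCurves.Tian2014.thm13_rank_one_and_sha_odd ∧ Literature.NumberTheory.QuadraticFields.RedeiReichardt.redeiReichardt_fourTwoCard_classGroup ∧ Literature.NumberTheory.EllipticCurves.LiLiuTian2024.thm12_bsd_congruentNumberCurve ∧ Literature.NumberTheory.EllipticCurves.Monsky1990.cor515_rank_eq_one_and_card_selmerGroup_two ∧ Literature.NumberTheory.EllipticCurves.HeathBrown1994.monsky_card_selmerGroup_two_even ∧ Literature.NumberTheory.EllipticCurves.Tian2014.tian2014_system_sMinus_genus) →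
    (∀ (W : WeierstrassCurve ℚ) [W.IsElliptic] [W.IsGloballyMinimal],
      W.HasCM → W.analyticRank = 1 → Literature.NumberTheory.EllipticCurves.Rank1Residual.CMRamified W 2 →
        ¬ Summit.BirchSwinnertonDyer.CongruentBookedIsogenyClass W →
        ¬ Summit.BirchSwinnertonDyer.Rank1Residual.P2.IsIsogenousToShuZhaiTwoFiftySixTwist W →
        ¬ Summit.BirchSwinnertonDyer.CongruentThetaFourIsogenyClass W →
        ¬ Summit.BirchSwinnertonDyer.CongruentThetaCriterionIsogenyClass W →
        5000 ≤ W.conductorNorm ℤ →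
        ¬ (∃ n : ℕ, Squarefree n ∧ (n % 8 = 5 ∨ n % 8 = 6 ∨ n % 8 = 7) ∧
            Nat.card ((congruentNumberCurve n).selmerGroup 2) = 2 ^ 5 ∧
            Nat.card ((congruentNumberCurve n).selmerGroup 4) = 2 ^ 6 ∧ IsIsogenous W (congruentNumberCurve n)) →
        Literature.NumberTheory.EllipticCurves.BSDp W 2)) :
    Summit.BirchSwinnertonDyer.BirchSwinnertonDyer.Theses.PrintCf2.RamifiedOffTYZOfFacts := fun hB ↦
  offTYZProved_of_bundle_of_uPlus_of_theta_of_shuZhai_of_thetaFour_of_thetaCriterion_of_smallConductor_of_offLarge hB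
    (hU hB) (hT hB) (hZ hB) (hT4 hB) (hTC hB) (hS hB) (offTYZ_residualV6_of_levelTwo_of_offJumpOneIsogeny hC hR hB)

/-- **Skeleton v7's composition as a corollary** (the v7 residual stub, off the ℚ-MODELS of jump-one `E_n`, in the residual
slot): v7's stub implies v8's (§3), so the v8 composition applies — which is why re-registering the skeleton as v8 invalidates
no proof aimed at v7. [folklore] -/
theorem ramifiedOffTYZOfFacts_of_leaves_of_levelTwo_of_offJumpOne
    (hU : (Literature.NumberTheory.EllipticCurves.rank_eq_analyticRank_of_analyticRank_le_one ∧ WeierstrassCurve.hasEntireLFunction_rat ∧ WeierstrassCurve.bsdRHS_eq_of_isIsogenous ∧ Literature.NumberTheory.EllipticCurves.bsdTriple_of_hasCM_of_L_one_ne_zero ∧ Literature.NumberTheory.EllipticCurves.TianYuanZhang2017.thm12_parity_of_scriptL' ∧ Literature.NumberTheory.EllipticCurves.Tian2014.thm13_rank_one_and_sha_odd ∧ Literature.NumberTheory.QuadraticFields.RedeiReichardt.redeiReichardt_fourTwoCard_classGroup ∧ Literature.NumberTheory.EllipticCurves.LiLiuTian2024.thm12_bsd_congruentNumberCurve ∧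 Literature.NumberTheory.EllipticCurves.Monsky1990.cor515_rank_eq_one_and_card_selmerGroup_two ∧ Literature.NumberTheory.EllipticCurves.HeathBrown1994.monsky_card_selmerGroup_two_even ∧ Literature.NumberTheory.EllipticCurves.Tian2014.tian2014_system_sMinus_genus) → Summit.BirchSwinnertonDyer.WAllCornerFTwoRamifiedTYZUPlus)
    (hT : (Literature.NumberTheory.EllipticCurves.rank_eq_analyticRank_of_analyticRank_le_one ∧ WeierstrassCurve.hasEntireLFunction_rat ∧ WeierstrassCurve.bsdRHS_eq_of_isIsogenous ∧ Literature.NumberTheory.EllipticCurves.bsdTriple_of_hasCM_of_L_one_ne_zero ∧ Literature.NumberTheory.EllipticCurves.TianYuanZhang2017.thm12_parity_of_scriptL' ∧ Literature.NumberTheory.EllipticCurves.Tian2014.thm13_rank_one_and_sha_odd ∧ Literature.NumberTheory.QuadraticFields.RedeiReichardt.redeiReichardt_fourTwoCard_classGroup ∧ Literature.NumberTheory.EllipticCurves.LiLiuTian2024.thm12_bsd_congruentNumberCurve ∧ Literature.NumberTheory.EllipticCurves.Monsky1990.cor515_rank_eq_one_and_card_selmerGroup_two ∧ Literature.NumberTheory.EllipticCurves.HeathBrown1994.monsky_card_selmerGroup_two_even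 ∧ Literature.NumberTheory.EllipticCurves.Tian2014.tian2014_system_sMinus_genus) → Summit.BirchSwinnertonDyer.WAllCornerFTwoRamifiedTheta)
    (hZ : (Literature.NumberTheory.EllipticCurves.rank_eq_analyticRank_of_analyticRank_le_one ∧ WeierstrassCurve.hasEntireLFunction_rat ∧ WeierstrassCurve.bsdRHS_eq_of_isIsogenous ∧ Literature.NumberTheory.EllipticCurves.bsdTriple_of_hasCM_of_L_one_ne_zero ∧ Literature.NumberTheory.EllipticCurves.TianYuanZhang2017.thm12_parity_of_scriptL' ∧ Literature.NumberTheory.EllipticCurves.Tian2014.thm13_rank_one_and_sha_odd ∧ Literature.NumberTheory.QuadraticFields.RedeiReichardt.redeiReichardt_fourTwoCard_classGroup ∧ Literature.NumberTheory.EllipticCurves.LiLiuTian2024.thm12_bsd_congruentNumberCurve ∧ Literature.NumberTheory.EllipticCurves.Monsky1990.cor515_rank_eq_one_and_card_selmerGroup_two ∧ Literature.NumberTheory.EllipticCurves.HeathBrown1994.monsky_card_selmerGroup_two_even ∧ Literature.NumberTheory.EllipticCurves.Tian2014.tian2014_system_sMinus_genus) → Summit.BirchSwinnertonDyer.WAl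lCornerFTwoRamifiedShuZhaiTwoFiftySix)
    (hT4 : (Literature.NumberTheory.EllipticCurves.rank_eq_analyticRank_of_analyticRank_le_one ∧ WeierstrassCurve.hasEntireLFunction_rat ∧ WeierstrassCurve.bsdRHS_eq_of_isIsogenous ∧ Literature.NumberTheory.EllipticCurves.bsdTriple_of_hasCM_of_L_one_ne_zero ∧ Literature.NumberTheory.EllipticCurves.TianYuanZhang2017.thm12_parity_of_scriptL' ∧ Literature.NumberTheory.EllipticCurves.Tian2014.thm13_rank_one_and_sha_odd ∧ Literature.NumberTheory.QuadraticFields.RedeiReichardt.redeiReichardt_fourTwoCard_classGroup ∧ Literature.NumberTheory.EllipticCurves.LiLiuTian2024.thm12_bsd_congruentNumberCurve ∧ Literature.NumberTheory.EllipticCurves.Monsky1990.cor515_rank_eq_one_and_card_selmerGroup_two ∧ Literature.NumberTheory.EllipticCurves.HeathBrown1994.monsky_card_selmerGroup_two_even ∧ Literature.NumberTheory.EllipticCurves.Tian2014.tian2014_system_sMinus_genus) → Summit.BirchSwinnertonDyer.WAllCornerFTwoRamifiedThetaFour)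
    (hTC : (Literature.NumberTheory.EllipticCurves.rank_eq_analyticRank_of_analyticRank_le_one ∧ WeierstrassCurve.hasEntireLFunction_rat ∧ WeierstrassCurve.bsdRHS_eq_of_isIsogenous ∧ Literature.NumberTheory.EllipticCurves.bsdTriple_of_hasCM_of_L_one_ne_zero ∧ Literature.NumberTheory.EllipticCurves.TianYuanZhang2017.thm12_parity_of_scriptL' ∧ Literature.NumberTheory.EllipticCurves.Tian2014.thm13_rank_one_and_sha_odd ∧ Literature.NumberTheory.QuadraticFields.RedeiReichardt.redeiReichardt_fourTwoCard_classGroup ∧ Literature.NumberTheory.EllipticCurves.LiLiuTian2024.thm12_bsd_congruentNumberCurve ∧ Literature.NumberTheory.EllipticCurves.Monsky1990.cor515_rank_eq_one_and_card_selmerGroup_two ∧ Literature.NumberTheory.EllipticCurves.HeathBrown1994.monsky_card_selmerGroup_two_even ∧ Literature.NumberTheory.EllipticCurves.Tian2014.tian2014_system_sMinus_genus) → Summit.BirchSwinnertonDyer.WAllCornerFTwoRamifiedThetaCriterion)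
    (hS : (Literature.NumberTheory.EllipticCurves.rank_eq_analyticRank_of_analyticRank_le_one ∧ WeierstrassCurve.hasEntireLFunction_rat ∧ WeierstrassCurve.bsdRHS_eq_of_isIsogenous ∧ Literature.NumberTheory.EllipticCurves.bsdTriple_of_hasCM_of_L_one_ne_zero ∧ Literature.NumberTheory.EllipticCurves.TianYuanZhang2017.thm12_parity_of_scriptL' ∧ Literature.NumberTheory.EllipticCurves.Tian2014.thm13_rank_one_and_sha_odd ∧ Literature.NumberTheory.QuadraticFields.RedeiReichardt.redeiReichardt_fourTwoCard_classGroup ∧ Literature.NumberTheory.EllipticCurves.LiLiuTian2024.thm12_bsd_congruentNumberCurve ∧ Literature.NumberTheory.EllipticCurves.Monsky1990.cor515_rank_eq_one_and_card_selmerGroup_two ∧ Literature.NumberTheory.EllipticCurves.HeathBrown1994.monsky_card_selmerGroup_two_even ∧ Literature.NumberTheory.EllipticCurves.Tian2014.tian2014_system_sMinus_genus) →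
    (∀ (W : WeierstrassCurve ℚ) [W.IsElliptic] [W.IsGloballyMinimal],
      W.HasCM → W.analyticRank = 1 → Literature.NumberTheory.EllipticCurves.Rank1Residual.CMRamified W 2 →
        W.conductorNorm ℤ < 5000 → Literature.NumberTheory.EllipticCurves.BSDp W 2))
    (hC : (∀ (n : ℕ) [(congruentNumberCurve n).IsElliptic] [(congruentNumberCurve n).IsGloballyMinimal],
      Squarefree n → (n % 8 = 5 ∨ n % 8 = 6 ∨ n % 8 = 7) →
      (congruentNumberCurve n).analyticRank = 1 →
      Nat.card ((congruentNumberCurve n).selmerGroup 2) = 2 ^ 5 →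
      Nat.card ((congruentNumberCurve n).selmerGroup 4) = 2 ^ 6 →
      ∀ L : ℤ, IsScriptL n L → (2 : ℤ) ∣ L ∧ ¬ (4 : ℤ) ∣ L))
    (h7 : (Literature.NumberTheory.EllipticCurves.rank_eq_analyticRank_of_analyticRank_le_one ∧ WeierstrassCurve.hasEntireLFunction_rat ∧ WeierstrassCurve.bsdRHS_eq_of_isIsogenous ∧ Literature.NumberTheory.EllipticCurves.bsdTriple_of_hasCM_of_L_one_ne_zero ∧ Literature.NumberTheory.EllipticCurves.TianYuanZhang2017.thm12_parity_of_scriptL' ∧ Literature.NumberTheory.EllipticCurves.Tian2014.thm13_rank_one_and_sha_odd ∧ Literature.NumberTheory.QuadraticFields.RedeiReichardt.redeiReichardt_fourTwoCard_classGroup ∧ Literature.NumberTheory.EllipticCurves.LiLiuTian2024.thm12_bsd_congruentNumberCurve ∧ Literature.NumberTheory.EllipticCurves.Monsky1990.cor515_rank_eq_one_and_card_selmerGroup_two ∧ Literature.NumberTheory.EllipticCurves.HeathBrown1994.monsky_card_selmerGroup_two_even ∧ Literature.NumberTheory.EllipticCurves.Tian2014.tian2014_system_sMinus_genus) →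
    (∀ (W : WeierstrassCurve ℚ) [W.IsElliptic] [W.IsGloballyMinimal],
      W.HasCM → W.analyticRank = 1 → Literature.NumberTheory.EllipticCurves.Rank1Residual.CMRamified W 2 →
        ¬ Summit.BirchSwinnertonDyer.CongruentBookedIsogenyClass W →
        ¬ Summit.BirchSwinnertonDyer.Rank1Residual.P2.IsIsogenousToShuZhaiTwoFiftySixTwist W →
        ¬ Summit.BirchSwinnertonDyer.CongruentThetaFourIsogenyClass W →
        ¬ Summit.BirchSwinnertonDyer.CongruentThetaCriterionIsogenyClass W →
        5000 ≤ W.conductorNorm ℤ →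
        ¬ (∃ (n : ℕ) (C : WeierstrassCurve.VariableChange ℚ), Squarefree n ∧ (n % 8 = 5 ∨ n % 8 = 6 ∨ n % 8 = 7) ∧
            Nat.card ((congruentNumberCurve n).selmerGroup 2) = 2 ^ 5 ∧
            Nat.card ((congruentNumberCurve n).selmerGroup 4) = 2 ^ 6 ∧ C • congruentNumberCurve n = W) →
        Literature.NumberTheory.EllipticCurves.BSDp W 2)) :
    Summit.BirchSwinnertonDyer.BirchSwinnertonDyer.Theses.PrintCf2.RamifiedOffTYZOfFacts :=
  ramifiedOffTYZOfFacts_of_leaves_of_levelTwo_of_offJumpOneIsogeny hU hT hZ hT4 hTC hS hC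
    (offJumpOneIsogeny_of_offJumpOne h7)

end Summit.BirchSwinnertonDyer.PrintCf2

end
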